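import Literature.GroupTheory.FiniteAbelian.SymplecticModules
import HarnessLib

/-!
# Route `CMKolyvaginAtInertTwo`, crux `CMKolyvaginExactAtInertTwo` (stmt-BirchSwinnertonDyer-24277):
# LAGRANGIANS AVOIDING A GIVEN SUBGROUP — the combinatorial input of (IND) for the lift groups of
# the adaptive telescope at `p = 2` (pure algebra on the tree's symplectic modules)

Seat `bsd-line-cmk2-p1` g14 (cell `bsd-print-cf2`); helper (`--supports stmt-BirchSwinnertonDyer-24277`).
THEOREMS ONLY: no definition, no named fact, no `sorry`; no item is closed; BSD is not proved by this.
Pure finite-abelian-group algebra (no number theory imported), sequel of the Literature files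
`FiniteAbelian/SymplecticModulesPlane.lean` (Wall's hyperbolic plane) and
`FiniteAbelian/SymplecticModules.lean` (the structure theorem `T = L ⊕ L'`).

WHY. The adaptive split-form Cassels–Tate telescope at `2` (`KolyvaginPairDataTwo.card_mul_card_le_two_
pow_of_pair`, p679105) takes two finite isotropic LIFT GROUPS `Zp`, `Zm` with the independence
condition **(IND)** `(Zp ⊔ Δ) ⊓ Zm = ⊥` (KERNEL-STATUS §12.1 item 7 (d); MEMO-T5 §4): the `2`-torsion
"bottoms" of the `E`-side lifts must avoid those of the `E^{(d_K)}`-side lifts inside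
`H¹(K, E[2^M])`. The lifts are lifts of maximal isotropic subgroups ("Lagrangians") of the finite
symplectic modules `Ш(E/ℚ)[2^∞]`, `Ш(E^{(d_K)}/ℚ)[2^∞]` (Cassels–Tate pairing; McCallum 1991 §5,
p. 307: "let `D` be a maximal isotropic subgroup"), so (IND) is a statement about CHOOSING
Lagrangians in general position. For a finite abelian group `T` with a bi-additive, alternating,
nondegenerate `B : T × T → ℚ/ℤ`, a **Lagrangian** below means an isotropic `L ≤ T` (`B(L, L) = 0`)
with `(#L)² = #T`. This file proves:

* `card_sup_le_mul`, `card_sup_eq_mul_of_disjoint`, `card_inf_mul_card_inf_le_of_disjoint` —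
  `#(L ⊔ L') ≤ #L · #L'`, with equality for disjoint `L, L'`; hence for disjoint `L, L'` and a finite
  `Z`: `#(L ∩ Z) · #(L' ∩ Z) ≤ #Z` ("halving").
* `exists_lagrangian_not_mem` — every non-zero `t` lies outside some Lagrangian;
  `exists_isotropic_sq_card_inf_sq_le` — one summand of a Lagrangian decomposition `T = L ⊕ L'`
  meets a given `Z` in a subgroup `W` with `(#W)² ≤ #Z`.
* `exists_lagrangian_inf_eq_bot_of_prime_nsmul` — **the transversal Lagrangian, elementary case**:
  if `p · T = 0` (`p` prime: `T` is a symplectic `𝔽_p`-space) and `Y ≤ T` has `(#Y)² ≤ #T`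
  (`dim Y ≤ ½ dim T`), some Lagrangian `L` has `L ∩ Y = 0`. Induction on `#T` through the hyperbolic
  plane: `0 ≠ e ∈ Y`, a partner `f ∉ Y` with `B(e, f) = 1/p` (if every partner lay in `Y` then
  `Y = T`), `T = ⟨e, f⟩ ⊕ H^⊥` (Wall's Lemma 1, `isCompl_hyperbolicPlane`), induction in `H^⊥` on the
  trace `Y' = (Y + ⟨f⟩) ∩ H^⊥` (`p · #Y' ≤ #Y`), and `L = L' + ⟨f⟩`.

The sequel `…LiftGroupsAtTwo` turns these into (IND) when one of the two Tate–Shafarevich `2`-parts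
is killed by `2`. What is NOT here: the filtered case (both `Ш`'s of exponent `≥ 4`), where a
subgroup of `T[2]` of order `≤ √#T` need NOT be avoidable (`T = (ℤ/2)² ⊕ (ℤ/4)²`, `Y = (2T)[2]`: every
Lagrangian meets `Y`) — see KERNEL-STATUS §13.

References: [McCallumLMS1991] §5 (p. 307); [Wall1963QuadraticFormsFiniteGroups] Lemma 1, Lemma 7;
[TignolAmitsur1986SymplecticModules] Prop. 2.2, Thm. 4.1.
-/

-- single-conjunct summit: `Summit.BirchSwinnertonDyer.BirchSwinnertonDyer.…` repeats the name by design
set_option linter.dupNamespace false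
set_option autoImplicit false

noncomputable section

open AddSubgroup

open Literature.GroupTheory.FiniteAbelian

namespace Summit.BirchSwinnertonDyer.BirchSwinnertonDyer.Theorems.KolyvaginLiftGroupsTwo

universe u v

section Symplectic

variable {T : Type u} [AddCommGroup T] (B : T →+ T →+ AddCircle (1 : ℚ))

/-! ### Small generalities -/

/-- For an alternating pairing, `B(x, y) = 0 ↔ B(y, x) = 0`. [folklore] -/
private theorem apply_eq_zero_comm_of_alt {Q : Type v} [AddCommGroup Q]
    (B : T →+ T →+ Q) (halt : ∀ x, B x x = 0) (x y : T) : B x y = 0 ↔ B y x = 0 := by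
  have h := halt (x + y)
  simp only [map_add, AddMonoidHom.add_apply, halt x, halt y, zero_add, add_zero] at h
  rw [eq_neg_of_add_eq_zero_right h, neg_eq_zero]

/-- The sum map `L × L' → T` has range `L ⊔ L'`. [folklore] -/
private theorem range_coprod_subtype' (L L' : AddSubgroup T) :
    (L.subtype.coprod L'.subtype).range = L ⊔ L' := by
  ext t
  simp only [AddMonoidHom.mem_range, AddMonoidHom.coprod_apply, coe_subtype, Prod.exists,
    Subtype.exists, exists_prop, AddSubgroup.mem_sup]

/-- The sum map `L × L' → T` of two disjoint subgroups is injective. [folklore] -/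
private theorem injective_coprod_subtype_of_disjoint' {L L' : AddSubgroup T} (h : Disjoint L L') :
    Function.Injective (L.subtype.coprod L'.subtype) := by
  rw [injective_iff_map_eq_zero]
  rintro ⟨a, b⟩ hab
  rw [AddMonoidHom.coprod_apply, coe_subtype, coe_subtype] at hab
  have ha : (a : T) ∈ L' := by
    have : (a : T) = -(b : T) := eq_neg_of_add_eq_zero_left hab
    rw [this]
    exact L'.neg_mem b.2
  have ha0 : (a : T) = 0 := (AddSubgroup.disjoint_def.mp h) a.2 ha
  have hb0 : (b : T) = 0 := by rwa [ha0, zero_add] at hab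
  ext <;> simp [ha0, hb0]

/-- `#(L ⊔ L') ≤ #L · #L'` for subgroups of an abelian group with `L, L'` finite. [folklore] -/
theorem card_sup_le_mul (L L' : AddSubgroup T) [Finite L] [Finite L'] :
    Nat.card ↥(L ⊔ L') ≤ Nat.card L * Nat.card L' := by
  haveI : Finite (L × L') := inferInstance
  rw [← Nat.card_prod, ← range_coprod_subtype' L L']
  exact Nat.card_le_card_of_surjective _ (AddMonoidHom.rangeRestrict_surjective _)

/-- `#(L ⊔ L') = #L · #L'` for DISJOINT subgroups of an abelian group. [folklore] -/
theorem card_sup_eq_mul_of_disjoint {L L' : AddSubgroup T} (h : Disjoint L L') :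
    Nat.card ↥(L ⊔ L') = Nat.card L * Nat.card L' := by
  rw [← Nat.card_prod, ← range_coprod_subtype' L L']
  exact (Nat.card_congr (AddMonoidHom.ofInjective
    (injective_coprod_subtype_of_disjoint' h)).toEquiv).symm

/-- **Halving.** For disjoint subgroups `L, L'` and a finite subgroup `Z`:
`#(L ∩ Z) · #(L' ∩ Z) ≤ #Z` (the two traces are disjoint subgroups of `Z`). [folklore] -/
theorem card_inf_mul_card_inf_le_of_disjoint {L L' : AddSubgroup T} (h : Disjoint L L')
    (Z : AddSubgroup T) [Finite Z] :
    Nat.card ↥(L ⊓ Z) * Nat.card ↥(L' ⊓ Z) ≤ Nat.card Z := by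
  have hd : Disjoint (L ⊓ Z) (L' ⊓ Z) := h.mono inf_le_left inf_le_left
  rw [← card_sup_eq_mul_of_disjoint hd]
  exact AddSubgroup.card_le_of_le (sup_le inf_le_right inf_le_right)

/-- An `n`-torsion element of `ℚ/ℤ` is an integer multiple of the class of `1/n`. [folklore] -/
private theorem exists_eq_zsmul_one_div {n : ℕ} (hn : 0 < n) {q : AddCircle (1 : ℚ)}
    (hq : n • q = 0) : ∃ a : ℤ, q = a • ((((1 : ℚ) / n : ℚ)) : AddCircle (1 : ℚ)) := by
  rw [AddCircle.nsmul_eq_zero_iff hn] at hq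
  obtain ⟨m, -, rfl⟩ := hq
  refine ⟨m, ?_⟩
  rw [← AddCircle.coe_zsmul, zsmul_eq_mul, Int.cast_natCast, mul_one, mul_one_div]

/-- The class of `1/n` in `ℚ/ℤ` is non-zero for `n ≥ 2`. [folklore] -/
private theorem coe_one_div_ne_zero {n : ℕ} (hn : 1 < n) :
    ((((1 : ℚ) / n : ℚ)) : AddCircle (1 : ℚ)) ≠ 0 := by
  rw [← AddMonoid.addOrderOf_eq_one_iff.ne, AddCircle.addOrderOf_period_div (by omega)]
  omega

/-! ### Avoiding one element -/

/-- **Every non-zero element lies outside some Lagrangian**: in a Lagrangian decomposition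
`T = L ⊕ L'` a non-zero `t` cannot lie in both summands. [cite: TignolAmitsur1986SymplecticModules, Thm. 4.1] -/
theorem exists_lagrangian_not_mem [Finite T] (halt : ∀ x, B x x = 0)
    (hnd : ∀ x, (∀ y, B x y = 0) → x = 0) {t : T} (ht : t ≠ 0) :
    ∃ L : AddSubgroup T, (∀ a ∈ L, ∀ b ∈ L, B a b = 0) ∧ Nat.card L ^ 2 = Nat.card T ∧ t ∉ L := by
  obtain ⟨L, L', hc, hL, hL', ⟨e⟩⟩ := exists_isCompl_isotropic_addEquiv B halt hnd
  have hcard : Nat.card T = Nat.card L * Nat.card L' := by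
    rw [← card_sup_eq_mul_of_disjoint hc.disjoint, hc.sup_eq_top, AddSubgroup.card_top]
  have hLL' : Nat.card L = Nat.card L' := Nat.card_congr e.toEquiv
  by_cases htL : t ∈ L
  · refine ⟨L', hL', by rw [hcard, hLL', sq], fun htL' ↦ ht ?_⟩
    exact (AddSubgroup.disjoint_def.mp hc.disjoint) htL htL'
  · exact ⟨L, hL, by rw [hcard, ← hLL', sq], htL⟩

/-- **One summand of a Lagrangian decomposition meets a given finite subgroup `Z` in a subgroup of
order at most `√#Z`.** [cite: TignolAmitsur1986SymplecticModules, Thm. 4.1] -/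
theorem exists_isotropic_sq_card_inf_sq_le [Finite T] (halt : ∀ x, B x x = 0)
    (hnd : ∀ x, (∀ y, B x y = 0) → x = 0) (Z : AddSubgroup T) :
    ∃ L : AddSubgroup T, (∀ a ∈ L, ∀ b ∈ L, B a b = 0) ∧ Nat.card L ^ 2 = Nat.card T ∧
      Nat.card ↥(L ⊓ Z) ^ 2 ≤ Nat.card Z := by
  obtain ⟨L, L', hc, hL, hL', ⟨e⟩⟩ := exists_isCompl_isotropic_addEquiv B halt hnd
  have hcard : Nat.card T = Nat.card L * Nat.card L' := by
    rw [← card_sup_eq_mul_of_disjoint hc.disjoint, hc.sup_eq_top, AddSubgroup.card_top]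
  have hLL' : Nat.card L = Nat.card L' := Nat.card_congr e.toEquiv
  have hprod := card_inf_mul_card_inf_le_of_disjoint hc.disjoint Z
  by_cases hle : Nat.card ↥(L ⊓ Z) ≤ Nat.card ↥(L' ⊓ Z)
  · refine ⟨L, hL, by rw [hcard, ← hLL', sq], ?_⟩
    calc Nat.card ↥(L ⊓ Z) ^ 2 = Nat.card ↥(L ⊓ Z) * Nat.card ↥(L ⊓ Z) := sq _
      _ ≤ Nat.card ↥(L ⊓ Z) * Nat.card ↥(L' ⊓ Z) := Nat.mul_le_mul_left _ hle
      _ ≤ Nat.card Z := hprod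
  · refine ⟨L', hL', by rw [hcard, hLL', sq], ?_⟩
    have hle' : Nat.card ↥(L' ⊓ Z) ≤ Nat.card ↥(L ⊓ Z) := le_of_not_ge hle
    calc Nat.card ↥(L' ⊓ Z) ^ 2 = Nat.card ↥(L' ⊓ Z) * Nat.card ↥(L' ⊓ Z) := sq _
      _ ≤ Nat.card ↥(L ⊓ Z) * Nat.card ↥(L' ⊓ Z) := Nat.mul_le_mul_right _ hle'
      _ ≤ Nat.card Z := hprod

/-! ### The transversal Lagrangian in the elementary case -/

/-- **A subgroup of order `≤ √#T` of a symplectic `𝔽_p`-space is avoided by some Lagrangian.**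
If `B : T × T → ℚ/ℤ` is alternating and nondegenerate on the finite abelian group `T`, `p · T = 0`
for a prime `p`, and `Y ≤ T` satisfies `(#Y)² ≤ #T`, then there is an isotropic `L ≤ T` with
`(#L)² = #T` and `L ∩ Y = 0`. (The finite-group form of "a subspace of dimension at most `n` of a
symplectic space of dimension `2n` is transversal to some Lagrangian"; induction through Wall's
hyperbolic plane.) [folklore] -/
theorem exists_lagrangian_inf_eq_bot_of_prime_nsmul [Finite T] (halt : ∀ x, B x x = 0)
    (hnd : ∀ x, (∀ y, B x y = 0) → x = 0) {p : ℕ} (hp : p.Prime) (hpT : ∀ t : T, p • t = 0)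
    (Y : AddSubgroup T) (hY : Nat.card Y ^ 2 ≤ Nat.card T) :
    ∃ L : AddSubgroup T, (∀ a ∈ L, ∀ b ∈ L, B a b = 0) ∧ Nat.card L ^ 2 = Nat.card T ∧
      L ⊓ Y = ⊥ := by
  suffices key : ∀ (k : ℕ) (T : Type u) [AddCommGroup T] [Finite T]
      (B : T →+ T →+ AddCircle (1 : ℚ)), (∀ x, B x x = 0) → (∀ x, (∀ y, B x y = 0) → x = 0) →
      (∀ t : T, p • t = 0) → ∀ Y : AddSubgroup T, Nat.card Y ^ 2 ≤ Nat.card T → Nat.card T = k →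
      ∃ L : AddSubgroup T, (∀ a ∈ L, ∀ b ∈ L, B a b = 0) ∧ Nat.card L ^ 2 = Nat.card T ∧
        L ⊓ Y = ⊥ from key _ T B halt hnd hpT Y hY rfl
  intro k
  induction k using Nat.strong_induction_on with
  | _ k ih =>
  intro T _ _ B halt hnd hpT Y hY hk
  haveI : Fact p.Prime := ⟨hp⟩
  have hp1 : 1 < p := hp.one_lt
  -- `Y = 0`: any Lagrangian will do
  by_cases hY0 : Y = ⊥
  · obtain ⟨L, hL, -, hLcard⟩ := exists_lagrangian_sq_eq_card B halt hnd
    exact ⟨L, hL, hLcard, by rw [hY0, inf_bot_eq]⟩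
  -- otherwise pick `0 ≠ e ∈ Y`, of order `p`
  obtain ⟨⟨e, heY⟩, he0⟩ := (AddSubgroup.ne_bot_iff_exists_ne_zero).mp hY0
  have he : e ≠ 0 := fun h ↦ he0 (Subtype.ext h)
  have hord : addOrderOf e = p := addOrderOf_eq_prime (hpT e) he
  set u : AddCircle (1 : ℚ) := ((((1 : ℚ) / p : ℚ)) : AddCircle (1 : ℚ)) with hu_def
  have hu0 : u ≠ 0 := coe_one_div_ne_zero hp1
  -- a partner `f` with `B(e, f) = 1/p`, chosen OUTSIDE `Y`
  obtain ⟨f, hef, hfY⟩ : ∃ f : T, B e f = u ∧ f ∉ Y := by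
    obtain ⟨f₀, hf₀⟩ := exists_apply_eq_coe_one_div B hnd e
    rw [hord, ← hu_def] at hf₀
    by_cases hf₀Y : f₀ ∈ Y
    swap
    · exact ⟨f₀, hf₀, hf₀Y⟩
    -- if every `f₀ + g`, `g ∈ ker B(e, ·)`, lay in `Y`, then `Y = T`, contradicting `(#Y)² ≤ #T`
    by_cases hker : ∃ g : T, B e g = 0 ∧ g ∉ Y
    · obtain ⟨g, hg, hgY⟩ := hker
      refine ⟨f₀ + g, by rw [map_add, hf₀, hg, add_zero], fun h ↦ hgY ?_⟩
      have := Y.sub_mem h hf₀Y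
      rwa [add_sub_cancel_left] at this
    push Not at hker
    exfalso
    have htop : ∀ t : T, t ∈ Y := by
      intro t
      obtain ⟨a, ha⟩ := exists_eq_zsmul_one_div hp.pos (q := B e t)
        (by rw [← AddMonoidHom.nsmul_apply, ← map_nsmul, hpT e, map_zero, AddMonoidHom.zero_apply])
      rw [← hu_def] at ha
      have hg : B e (t - a • f₀) = 0 := by rw [map_sub, map_zsmul, hf₀, ha, sub_self]
      have := Y.add_mem (hker _ hg) (Y.zsmul_mem hf₀Y a)
      rwa [sub_add_cancel] at this
    have hYtop : Y = ⊤ := by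
      rw [eq_top_iff]
      exact fun t _ ↦ htop t
    have hcardY : Nat.card Y = Nat.card T := by rw [hYtop, AddSubgroup.card_top]
    rw [hcardY, sq] at hY
    have h1 : Nat.card T ≤ 1 := by
      by_contra h
      push Not at h
      have := Nat.mul_lt_mul_of_lt_of_le h (le_refl (Nat.card T)) Nat.card_pos
      rw [one_mul] at this
      exact absurd hY (not_le.mpr this)
    haveI : Subsingleton T := Finite.card_le_one_iff_subsingleton.mp h1
    exact he (Subsingleton.elim e 0)
  have hpe : p • e = 0 := hpT e
  have hpf : p • f = 0 := hpT f
  -- the plane `H = ⟨e, f⟩` and its orthogonal `Hp`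
  obtain ⟨hdisj, hHc⟩ := isCompl_hyperbolicPlane B halt hp.pos hpe hpf hef
  set H : AddSubgroup T := zmultiples e ⊔ zmultiples f with hH_def
  set Hp : AddSubgroup T := (B.flip e).ker ⊓ (B.flip f).ker with hHp_def
  have hmemHp : ∀ t, t ∈ Hp ↔ B t e = 0 ∧ B t f = 0 := fun t ↦ by
    rw [hHp_def, AddSubgroup.mem_inf, AddMonoidHom.mem_ker, AddMonoidHom.mem_ker,
      AddMonoidHom.flip_apply, AddMonoidHom.flip_apply]
  -- the restricted pairing
  set Bp : Hp →+ Hp →+ AddCircle (1 : ℚ) := (B.comp Hp.subtype).compl₂ Hp.subtype with hBp_def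
  have hBp : ∀ a b : Hp, Bp a b = B a b := fun a b ↦ rfl
  have haltp : ∀ a : Hp, Bp a a = 0 := fun a ↦ by rw [hBp, halt]
  have hndp : ∀ a : Hp, (∀ b : Hp, Bp a b = 0) → a = 0 :=
    nondegenerate_restrict_hyperbolicPlane B halt hnd hp.pos hpe hpf hef
  have hpTp : ∀ a : Hp, p • a = 0 := fun a ↦ Subtype.ext (by
    rw [AddSubgroup.coe_nsmul, hpT, AddSubgroup.coe_zero])
  -- cardinalities: `#H = p²`, `#T = #H · #Hp`
  have hordf : addOrderOf f = p := by
    refine addOrderOf_eq_prime hpf fun hf ↦ hu0 ?_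
    rw [← hef, hf, map_zero]
  have hcardH : Nat.card H = p * p := by
    rw [hH_def, card_sup_eq_mul_of_disjoint hdisj, Nat.card_zmultiples, Nat.card_zmultiples, hord,
      hordf]
  have hcardT : Nat.card T = p * p * Nat.card Hp := by
    rw [← hcardH, ← card_sup_eq_mul_of_disjoint hHc.disjoint, hHc.sup_eq_top, AddSubgroup.card_top]
  have hcardHp : Nat.card Hp < k := by
    rw [← hk, hcardT]
    have h1 : 1 < p * p := Nat.one_lt_mul_iff.mpr ⟨hp.pos, hp.pos, Or.inl hp1⟩
    have := Nat.card_pos (α := Hp)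
    nlinarith
  -- the trace `Y' = (Y + ⟨f⟩) ∩ Hp`, as a subgroup of `Hp`
  set X : AddSubgroup T := Y ⊔ zmultiples f with hX_def
  set Y' : AddSubgroup Hp := X.comap Hp.subtype with hY'_def
  have hmemY' : ∀ a : Hp, a ∈ Y' ↔ (a : T) ∈ X := fun a ↦ by rw [hY'_def, AddSubgroup.mem_comap]; rfl
  -- `p · #Y' ≤ #Y`: `X ⊇ (X ∩ Hp) ⊕ H`, `#X ≤ p · #Y`
  haveI : Finite Y := inferInstance
  have hcardY' : Nat.card Y' ^ 2 ≤ Nat.card Hp := by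
    have hY'map : Nat.card Y' = Nat.card ↥(X ⊓ Hp) := by
      have h1 : Y'.map Hp.subtype = X ⊓ Hp := by
        rw [hY'_def]
        ext t
        simp only [AddSubgroup.mem_map, AddSubgroup.mem_comap, AddSubgroup.coe_subtype,
          AddSubgroup.mem_inf]
        constructor
        · rintro ⟨a, ha, rfl⟩
          exact ⟨ha, a.2⟩
        · rintro ⟨ht, htHp⟩
          exact ⟨⟨t, htHp⟩, ht, rfl⟩
      rw [← h1]
      exact Nat.card_congr (AddSubgroup.equivMapOfInjective Y' Hp.subtype Hp.subtype_injective).toEquiv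
    have hHX : H ≤ X := by
      rw [hH_def, hX_def]
      exact sup_le ((AddSubgroup.zmultiples_le_of_mem heY).trans le_sup_left) le_sup_right
    have hdisj2 : Disjoint (X ⊓ Hp) H := hHc.symm.disjoint.mono inf_le_right le_rfl
    have hle1 : Nat.card ↥(X ⊓ Hp) * (p * p) ≤ Nat.card X := by
      rw [← hcardH, ← card_sup_eq_mul_of_disjoint hdisj2]
      exact AddSubgroup.card_le_of_le (sup_le inf_le_left hHX)
    have hle2 : Nat.card X ≤ Nat.card Y * p := by
      have h := card_sup_le_mul Y (zmultiples f)
      rwa [Nat.card_zmultiples, hordf, ← hX_def] at h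
    have hle3 : Nat.card ↥(X ⊓ Hp) * p ≤ Nat.card Y := by
      have : Nat.card ↥(X ⊓ Hp) * p * p ≤ Nat.card Y * p := by
        rw [mul_assoc]; exact hle1.trans hle2
      exact Nat.le_of_mul_le_mul_right this hp.pos
    have hle4 : (Nat.card ↥(X ⊓ Hp) * p) ^ 2 ≤ p * p * Nat.card Hp := by
      rw [← hcardT]
      exact (Nat.pow_le_pow_left hle3 2).trans hY
    rw [hY'map]
    have : Nat.card ↥(X ⊓ Hp) ^ 2 * (p * p) ≤ Nat.card Hp * (p * p) := by
      calc Nat.card ↥(X ⊓ Hp) ^ 2 * (p * p) = (Nat.card ↥(X ⊓ Hp) * p) ^ 2 := by ring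
        _ ≤ p * p * Nat.card Hp := hle4
        _ = Nat.card Hp * (p * p) := by ring
    exact Nat.le_of_mul_le_mul_right this (Nat.mul_pos hp.pos hp.pos)
  -- induction in `Hp`
  obtain ⟨L₀, hiso₀, hcard₀, hinf₀⟩ := ih _ hcardHp Hp Bp haltp hndp hpTp Y' hcardY' rfl
  set L₁ : AddSubgroup T := L₀.map Hp.subtype with hL₁_def
  have hL₁le : L₁ ≤ Hp := AddSubgroup.map_subtype_le L₀
  have hisoL₁ : ∀ a ∈ L₁, ∀ b ∈ L₁, B a b = 0 := by
    intro a ha b hb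
    obtain ⟨a₀, ha₀, rfl⟩ := AddSubgroup.mem_map.mp ha
    obtain ⟨b₀, hb₀, rfl⟩ := AddSubgroup.mem_map.mp hb
    exact hiso₀ a₀ ha₀ b₀ hb₀
  have hcardL₁ : Nat.card L₁ = Nat.card L₀ :=
    (Nat.card_congr (AddSubgroup.equivMapOfInjective L₀ Hp.subtype Hp.subtype_injective).toEquiv).symm
  -- the Lagrangian `L = L₁ + ⟨f⟩`
  have hdisjL : Disjoint L₁ (zmultiples f) :=
    hHc.symm.disjoint.mono hL₁le (le_sup_right (a := zmultiples e))
  refine ⟨L₁ ⊔ zmultiples f, ?_, ?_, ?_⟩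
  · -- isotropic
    intro a ha b hb
    obtain ⟨a₁, ha₁, a₂, ha₂, rfl⟩ := AddSubgroup.mem_sup.mp ha
    obtain ⟨b₁, hb₁, b₂, hb₂, rfl⟩ := AddSubgroup.mem_sup.mp hb
    obtain ⟨k, rfl⟩ := AddSubgroup.mem_zmultiples_iff.mp ha₂
    obtain ⟨m, rfl⟩ := AddSubgroup.mem_zmultiples_iff.mp hb₂
    have h1 : B a₁ (m • f) = 0 := by rw [map_zsmul, ((hmemHp a₁).mp (hL₁le ha₁)).2, smul_zero]
    have h2 : B (k • f) b₁ = 0 := by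
      rw [apply_eq_zero_comm_of_alt B halt, map_zsmul, ((hmemHp b₁).mp (hL₁le hb₁)).2, smul_zero]
    have h3 : B (k • f) (m • f) = 0 := by
      rw [map_zsmul, map_zsmul, AddMonoidHom.zsmul_apply, halt f, smul_zero, smul_zero]
    simp only [map_add, AddMonoidHom.add_apply, hisoL₁ a₁ ha₁ b₁ hb₁, h1, h2, h3, add_zero]
  · -- order
    rw [card_sup_eq_mul_of_disjoint hdisjL, hcardL₁, Nat.card_zmultiples, hordf, hcardT, mul_pow,
      hcard₀]
    ring
  · -- transversal to `Y`
    rw [eq_bot_iff]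
    intro y hy
    obtain ⟨hyL, hyY⟩ := AddSubgroup.mem_inf.mp hy
    obtain ⟨a, ha, b, hb, rfl⟩ := AddSubgroup.mem_sup.mp hyL
    obtain ⟨a₀, ha₀, rfl⟩ := AddSubgroup.mem_map.mp ha
    -- `a = y - b ∈ (Y + ⟨f⟩) ∩ Hp = Y'`, hence `a = 0`
    have haX : (Hp.subtype a₀ : T) ∈ X := by
      have : (Hp.subtype a₀ : T) = (Hp.subtype a₀ + b) - b := by rw [add_sub_cancel_right]
      rw [this, hX_def]
      exact AddSubgroup.sub_mem _ (AddSubgroup.mem_sup_left hyY) (AddSubgroup.mem_sup_right hb)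
    have ha₀Y' : a₀ ∈ Y' := (hmemY' a₀).mpr haX
    have ha₀0 : a₀ = 0 := by
      have : a₀ ∈ L₀ ⊓ Y' := AddSubgroup.mem_inf.mpr ⟨ha₀, ha₀Y'⟩
      rwa [hinf₀, AddSubgroup.mem_bot] at this
    rw [ha₀0, map_zero, zero_add] at hyY ⊢
    -- `b ∈ ⟨f⟩ ∩ Y` with `f ∉ Y` and `f` of prime order: `b = 0`
    rw [AddSubgroup.mem_bot]
    by_contra hb0
    have hordb : addOrderOf b = p := addOrderOf_eq_prime (hpT b) hb0
    have hle : zmultiples b ≤ zmultiples f := AddSubgroup.zmultiples_le_of_mem hb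
    have heq : zmultiples b = zmultiples f := by
      refine AddSubgroup.eq_of_le_of_card_ge hle ?_
      rw [Nat.card_zmultiples, Nat.card_zmultiples, hordf, hordb]
    have hfY' : f ∈ zmultiples b := by rw [heq]; exact AddSubgroup.mem_zmultiples f
    exact hfY ((AddSubgroup.zmultiples_le_of_mem hyY) hfY')

end Symplectic

end Summit.BirchSwinnertonDyer.BirchSwinnertonDyer.Theorems.KolyvaginLiftGroupsTwo

end
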